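import Literature.MathematicalPhysics.QuantumFieldTheory.Balaban1983to89.B9Thm312WholeClasses

/-!
# `Balaban1983to89.B9Thm312WholeStepFrom3131` — [B9] Theorem 3.12 (pp. 421–423): THE SUP-CLASS PERTURBATION STEP OF THE
# SECT.-D LEAVES (`B9Thm312Whole.Step`, p = 1, 2) PROVED from Theorem 3.3 for G₀ and the printed letters (3.131) ∕ (3.137) of
# Δ′_π, Δ⁽²⁾_π — the gauge-mode derivative moved to the left (p. 421), one composition ([4] (2.54) + (2.61)) and one scale
# transfer (p. 398 ∕ [4] (2.60))

T. Bałaban, *Propagators for lattice gauge theories in a background field*, Commun. Math. Phys. **99** (1985) 389–434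
[`Balaban1985BackgroundPropagators`, "B9"]; [4] = T. Bałaban, *Propagators and renormalization transformations for lattice gauge
theories. II*, Commun. Math. Phys. **96** (1984) 223–250 [`Balaban1984PropagatorsII`].

statement-level skeleton of published theorems with citation tags; proofs where landed; nothing here is a claim about the Yang–Mills
mass gap

THE PRINTED LOCUS (verbatim, held text `paper:balaban1985-cmp99-background-propagators`).  p. 421: *"From (3.120) we get
G = G₀(I − Δ′_πG₀)⁻¹ = Σ_{n=0}^∞ G₀(Δ′_πG₀)ⁿ. (3.130)  It is easy to find estimates for the operator Δ′_π, using Theorem 3.1 and the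
inequality (3.49), we have to be careful only with the third term in the definition (3.120) of Δ′_π. One of the three derivatives
there has to be applied either to an expression on the right, or on the left, of Δ′_π. For example one of the terms in ⟨A₁, Δ′_πA₂⟩
is … and we apply the derivative D\* to A₁. We have … for supp A₁ ⊂ Δ(y), y ∈ Λ_j, supp A₂ ⊂ Δ(y′), y′ ∈ Λ_{j′}. (3.131)  This
inequality and Theorem 3.3 for G₀ imply a convergence of the series (3.130), for α₀ sufficiently small"*; p. 423: *"|(Δ⁽²⁾A)(b)| ≦
O(1)Mα₀(Lʲη)⁻²|A|, b ∈ Δ(y), y ∈ Λ_j (3.137) and the supremum |A| is taken over several j-blocks surrounding Δ(y). This bound implies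
that the operators Δ⁽²⁾, Δ⁽²⁾_π are small in a proper sense … G₁ = G₀(I − (Δ′_π + Δ⁽²⁾_π)G₀)⁻¹ (3.138) … we have derivatives in the
operator Δ′_π + Δ⁽²⁾_π which have to be applied either to the operator on the right, or on the left"*; (3.135): *"Δ⁽²⁾_π = Δ⁽²⁾ −
DRG′D\*Δ⁽²⁾ − Δ⁽²⁾DG′RD\* + DRG′D\*Δ⁽²⁾DG′RD\*"*; p. 398: *"the choice of powers Lʲη is conventional also. Using Lemma 2.1 in [4] we
may replace the factor (Lʲη)^α by (Lʲη)^β(L^{j′}η)^γ with β + γ = α"*.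

THE POINT.  The Sect.-D leaves of this lineage (rows 20–21 of N06-ASSIGNMENT v1; consumed at def-Y's instance by n06-d's
`N06Thm312313AtPinsPairM.t312_t313_of_pins_pairM`, binder `hmodel12`) display the SUP-CLASS PERTURBATION STEP as the hypothesis schema
`B9Thm312Whole.Step 𝔬 R₀ H₀ hlen p θ δK U` (p = 1 and p = 2): the products K′ = G₀Δ′_π and K′₁ = G₀(Δ′_π + Δ⁽²⁾_π) have the block
majorant θe^{−δ_K d} on the state norm 𝔠⁽ᵖ⁾.  Print derives exactly this from TWO more primitive facts: Theorem 3.3 for G₀ (which,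
after `B9Thm312WholeFromThm310`, rows 20–21 take from rows 18's Theorem 3.10) and the estimate (3.131) ∕ (3.137) OF THE PERTURBATION
OPERATORS THEMSELVES, the only subtlety being the gauge-mode derivative D of the third term of (3.120) (and the left factor
I − DRG′D\* of (3.135)), which *"has to be applied … on the left"* — i.e. lands on G₀ as the entry G₀D.  THIS FILE types that
derivation at the `Ops` level:

* §1 `Letters3131 𝔬 Ta Ta₂ Tb Tb₂ R₀ H₀ hlen t δT U` — THE (3.131) ∕ (3.137) LETTERS, printed shape, nothing asserted: Δ′_π(U) =
  T_a + D·T_b and Δ⁽²⁾_π(U) = T_a₂ + D·T_b₂ (D = `𝔬.Dv U`, the derivative moved to the left) with the small local majorants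
  T_a, T_a₂ : 𝔠⁽²⁾ → 𝔠⁽⁰⁾ and T_b, T_b₂ : 𝔠⁽²⁾ → 𝔠_W⁽¹⁾ of shape t·e^{−δ_T d} (t = O(1)·Mα₀ in print: *"each operator Δ′_π provides the
  small factor α₀"*, p. 422).  Pattern credit: r06's matrix-level `B9Thm312PositivityAssembled.hasMaj_G0_mul_step` (G₀Δ′_π =
  (G₀ ⊕ G₀D)∘𝒯₁); nothing of it is restated or imported here.
* §2 `hasMaj_G0_cNorm` (Theorem 3.3 (3.42)₁ for G₀ read as G₀ : 𝔠⁽⁰⁾ → 𝔠⁽²⁾ with B₀e^{−δ₀d}), `hasMaj_G0_comp_split` (ONE composition: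
  G₀T = G₀T_a + (G₀D)T_b : 𝔠⁽²⁾ → 𝔠⁽²⁾ with (B₀ + B₃)·t·c·e^{−ρd}, [4] (2.54) + Lemma 2.1 (2.61) at the margin σ),
  `hasMaj_cNorm_one_of_two` (ONE scale transfer: a majorant C·e^{−rd} on 𝔠⁽²⁾ is the majorant C·L₀·e^{−(r−αδ)d} on 𝔠⁽¹⁾, p. 398 ∕ [4]
  (2.60) through n06-k's member facts `Facts347`).
* §3 ★ `step_of_letters3131` — `Step 𝔬 R₀ H₀ hlen 1 θ δK U ∧ Step 𝔬 R₀ H₀ hlen 2 θ δK U` (the two `hmodel12` conjuncts, in their order)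
  from `Thm33G0 𝔬 R₀ H₀ B₀ δ₀ U` (its `e0`), the G₀D letter (`Letters313.gD2`'s shape: G₀D : 𝔠_W⁽¹⁾ → 𝔠⁽²⁾, B₃e^{−δ₃d}), `Letters3131`,
  the row sum (2.61) at rate σ and `Facts347`, for EVERY θ ≧ 2(B₀ + B₃)·t·c·L₀ and δ_K ≦ ρ − αδ (ρ ≦ δ_T, ρ + σ ≦ δ₀, ρ + σ ≦ δ₃).

HONEST SCOPE.  Kernel-checked bookkeeping: two displayed operator-product hypotheses of rows 20–21 become theorems of ONE displayed
letter hypothesis about Δ′_π, Δ⁽²⁾_π alone (still a HYPOTHESIS SCHEMA of printed shape — (3.131) ∕ (3.137) are not proved here; their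
derivation from (3.120), (3.135), Theorem 3.1, (3.49), (3.36) and [5] (149) is the located gap G-B9-16) plus Theorem 3.3 for G₀.  The
steps in the OTHER classes (`LeftStep.stepD`, `StepDir`, `StepH`, `StepL2` — where print moves derivatives to the right as well and the
state space is the whole of (3.42)–(3.46)), `FormSmall` and `Identities` stay displayed.  LOCATED REMARK (design, not a claim): like
the schema `Step` it proves, `Letters3131` reads the perturbation operators on RAW inputs of the sup class 𝔠⁽²⁾, whereas print estimates
them only between propagators (every factor of (3.130) ∕ (3.138) is followed by a G₀; p. 423 displays the bound for Δ⁽²⁾_πG₀) and in the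
full state space of (3.42)–(3.46) (which carries |∇_UA| and the Hölder sizes); the uniformity in the member of the small constant t for
the Δ⁽²⁾_π letters (whose right factor I − DG′RD\* of (3.135) then meets raw inputs) is therefore print's only through that state space —
a right-form step T∘G₀ : 𝔠⁽⁰⁾ → 𝔠⁽⁰⁾ would be the print-closer schema; not typed here.  COUNT-NEUTRAL; N06 is NOT discharged; one finite
lattice at a time; nothing continuum, nothing about the mass gap.  Cell `pub-ymgap` (HUMAN RULING D-0062), Track A node N06 [B9],
N06-ASSIGNMENT v1 rows 20–21 (bundle F7), seat `pub-ymgap-dag-n06-l` (g11), 2026-08-27.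
-/

namespace Literature.MathematicalPhysics.QuantumFieldTheory.Balaban1983to89.B9Thm312WholeStepFrom3131

open Literature.MathematicalPhysics.QuantumFieldTheory.Balaban1983to89
open Finset B6RandomWalk B6RandomWalkHom B9Thm34Ext B11SectG B9SectDSup B9Thm312Whole B9Thm312WholeLeaf
open B9RWSums343to347Whole B9RWSums346Schur

noncomputable section

variable {g : B9.Geometry} {B : B9.Backgrounds} {X Y Z W : Type}
variable [Fintype X] [Fintype W] [Fintype g.Site]
variable {R₀ : ℝ} {H₀ : Prop}

/-! ## §1 The (3.131) ∕ (3.137) letters of Δ′_π and Δ⁽²⁾_π (printed shape; nothing asserted) -/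

/-- **THE LETTERS (3.131) ∕ (3.137) OF THE PERTURBATION OPERATORS, WITH THE GAUGE-MODE DERIVATIVE MOVED TO THE LEFT** (p. 421:
*"One of the three derivatives there has to be applied either to an expression on the right, or on the left, of Δ′_π … and we
apply the derivative D\* to A₁"*; (3.135): Δ⁽²⁾_π = (I − DRG′D\*)Δ⁽²⁾(I − DG′RD\*)): at the configuration U,
Δ′_π = T_a + D·T_b (`split`) and Δ⁽²⁾_π = T_a₂ + D·T_b₂ (`split₂`), D = the gauge-mode derivative `𝔬.Dv U` of DRD\*, where the
derivative-free parts T_a, T_a₂ map the state norm 𝔠⁽²⁾ into 𝔠⁽⁰⁾ (*"|(Δ⁽²⁾A)(b)| ≦ O(1)Mα₀(Lʲη)⁻²|A|"*, (3.137); the scale factor is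
placed at the source block, conventional by p. 398) and the parts under the derivative T_b, T_b₂ map 𝔠⁽²⁾ into the scalar-field
class 𝔠_W⁽¹⁾, all four with the small local block majorant t·e^{−δ_T d(y,y′)} (t = O(1)·Mα₀ in print, p. 422: *"each operator Δ′_π
provides the small factor α₀"*).  A HYPOTHESIS SCHEMA over FREE letters `Ta Ta₂ Tb Tb₂` (nothing constructed or asserted); its
derivation from (3.120), (3.135)–(3.137), Theorem 3.1, (3.49), (3.36) is not typed here.
[cite: Balaban1985BackgroundPropagators, (3.130)–(3.131) pp.421–422 + (3.135)–(3.137) pp.422–423 + p.398 (remark after (3.47))] -/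
structure Letters3131 (𝔬 : Ops g B X Y Z W) (Ta Ta₂ : B.Cfg → Module.End ℝ (X → ℝ))
    (Tb Tb₂ : B.Cfg → (X → ℝ) →ₗ[ℝ] (W → ℝ)) (R₀ : ℝ) (H₀ : Prop) (hlen : ∀ y : g.Site, 0 ≤ g.len y) (t δT : ℝ)
    (U : B.Cfg) : Prop where
  split : 𝔬.Tpi U = Ta U + 𝔬.Dv U ∘ₗ Tb U
  split₂ : 𝔬.T2 U = Ta₂ U + 𝔬.Dv U ∘ₗ Tb₂ U
  ta : HasMaj (cNorm R₀ H₀ 𝔬.blk hlen 2) (cNorm R₀ H₀ 𝔬.blk hlen 0) (Ta U)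
    (fun a b => t * Real.exp (-(δT * g.dist a b)))
  tb : HasMaj (cNorm R₀ H₀ 𝔬.blk hlen 2) (cNorm R₀ H₀ 𝔬.blkW hlen 1) (Tb U)
    (fun a b => t * Real.exp (-(δT * g.dist a b)))
  ta₂ : HasMaj (cNorm R₀ H₀ 𝔬.blk hlen 2) (cNorm R₀ H₀ 𝔬.blk hlen 0) (Ta₂ U)
    (fun a b => t * Real.exp (-(δT * g.dist a b)))
  tb₂ : HasMaj (cNorm R₀ H₀ 𝔬.blk hlen 2) (cNorm R₀ H₀ 𝔬.blkW hlen 1) (Tb₂ U)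
    (fun a b => t * Real.exp (-(δT * g.dist a b)))

/-! ## §2 One entry, one composition, one scale transfer -/

omit [Fintype X] [Fintype W] [Fintype g.Site] in
/-- Kernel monotonicity: C·e^{−rd} ≦ θ·e^{−δ_K d} for 0 ≦ C ≦ θ, δ_K ≦ r, d ≧ 0. [folklore] -/
private theorem kernel_le {C θ r δK d : ℝ} (hC : 0 ≤ C) (hCθ : C ≤ θ) (hδK : δK ≤ r) (hd : 0 ≤ d) :
    C * Real.exp (-(r * d)) ≤ θ * Real.exp (-(δK * d)) :=
  calc C * Real.exp (-(r * d)) ≤ C * Real.exp (-(δK * d)) :=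
      mul_le_mul_of_nonneg_left (Real.exp_le_exp.mpr (neg_le_neg (mul_le_mul_of_nonneg_right hδK hd))) hC
    _ ≤ θ * Real.exp (-(δK * d)) := mul_le_mul_of_nonneg_right hCθ (Real.exp_nonneg _)

omit [Fintype W] in
/-- **THEOREM 3.3 (3.42)₁ FOR G₀ AS A MAP OF STATE CLASSES**: the [4]-(2.51) majorant |(G₀λ)(x)| ≦ B₀(Lʲη)²e^{−δ₀d(y,y′)}|λ| (x ∈ Δ(y),
supp λ ⊂ Δ(y′)) is the majorant B₀e^{−δ₀d} of G₀ from 𝔠⁽⁰⁾ into 𝔠⁽²⁾ (the power (Lʲη)² taken inside the target size).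
[cite: Balaban1985BackgroundPropagators, Thm 3.3 p.399 + (3.42) p.397; Balaban1984PropagatorsII, (2.51) p.232] -/
theorem hasMaj_G0_cNorm (hG : GeoOK g) {blk : X → g.Site} {G0 : Module.End ℝ (X → ℝ)} {B₀ δ₀ : ℝ} (hB₀ : 0 ≤ B₀)
    (he0 : HasMajorant (g := toB6 g R₀ H₀) blk G0 (fun a b => B₀ * g.len a ^ 2 * Real.exp (-(δ₀ * g.dist a b)))) :
    HasMaj (cNorm R₀ H₀ blk hG.lenle 0) (cNorm R₀ H₀ blk hG.lenle 2) G0 (fun a b => B₀ * Real.exp (-(δ₀ * g.dist a b))) := by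
  have h0 : HasMaj (BlockNorm.ofBlocks (toB6 g R₀ H₀) blk) (BlockNorm.ofBlocks (toB6 g R₀ H₀) blk) G0
      (fun a b => B₀ * g.len a ^ 2 * Real.exp (-(δ₀ * g.dist a b))) :=
    hasMaj_of_hasMajorant (g := toB6 g R₀ H₀) blk
      (fun a b => mul_nonneg (mul_nonneg hB₀ (sq_nonneg _)) (Real.exp_nonneg _)) he0
  refine (hasMaj_cNorm_of_hasMaj hG 2 0 h0).mono fun y y' => le_of_eq ?_
  have hy : g.len y ^ 2 ≠ 0 := pow_ne_zero 2 (hG.lenpos y).ne'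
  simp only [wt, pow_zero, mul_one]
  rw [mul_assoc B₀, mul_comm (g.len y ^ 2), ← mul_assoc B₀, mul_assoc, mul_assoc, mul_inv_cancel₀ hy, mul_one]

/-- **ONE COMPOSITION — THE PRODUCT G₀T FOR A SPLIT PERTURBATION T = T_a + D·T_b**: with G₀ : 𝔠⁽⁰⁾ → 𝔠⁽²⁾ (B₀e^{−δ₀d}), the entry
G₀D : 𝔠_W⁽¹⁾ → 𝔠⁽²⁾ (B₃e^{−δ₃d}) and the letters T_a : 𝔠⁽²⁾ → 𝔠⁽⁰⁾, T_b : 𝔠⁽²⁾ → 𝔠_W⁽¹⁾ (t·e^{−δ_T d}), the product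
G₀T = G₀T_a + (G₀D)T_b maps 𝔠⁽²⁾ into itself with the majorant (B₀ + B₃)·t·c·e^{−ρd} for every ρ ≧ 0 with ρ ≦ δ_T, ρ + σ ≦ δ₀,
ρ + σ ≦ δ₃ — [4] (2.54) and Lemma 2.1 (2.61) at the margin σ (the sharp-block classes have cutting cost 1).  *"This inequality
[(3.131)] and Theorem 3.3 for G₀ imply …"* (p. 422).
[cite: Balaban1985BackgroundPropagators, (3.130)–(3.131) pp.421–422; Balaban1984PropagatorsII, (2.52)–(2.56) pp.232–233 + Lemma 2.1 (2.61) p.234] -/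
theorem hasMaj_G0_comp_split (hG : GeoOK g) {blk : X → g.Site} {blkW : W → g.Site}
    {G0 T Ta : Module.End ℝ (X → ℝ)} {Dv : (W → ℝ) →ₗ[ℝ] (X → ℝ)} {Tb : (X → ℝ) →ₗ[ℝ] (W → ℝ)}
    {B₀ B₃ t δ₀ δ₃ δT ρ σ c : ℝ} (hrow : RowSum (toB6 g R₀ H₀) σ c)
    (hB₀ : 0 ≤ B₀) (hB₃ : 0 ≤ B₃) (ht : 0 ≤ t) (hρ : 0 ≤ ρ) (hρT : ρ ≤ δT) (hρ₀ : ρ + σ ≤ δ₀) (hρ₃ : ρ + σ ≤ δ₃)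
    (hsplit : T = Ta + Dv ∘ₗ Tb)
    (hG0 : HasMaj (cNorm R₀ H₀ blk hG.lenle 0) (cNorm R₀ H₀ blk hG.lenle 2) G0
      (fun a b => B₀ * Real.exp (-(δ₀ * g.dist a b))))
    (hGD : HasMaj (cNorm R₀ H₀ blkW hG.lenle 1) (cNorm R₀ H₀ blk hG.lenle 2) (G0 ∘ₗ Dv)
      (fun a b => B₃ * Real.exp (-(δ₃ * g.dist a b))))
    (hta : HasMaj (cNorm R₀ H₀ blk hG.lenle 2) (cNorm R₀ H₀ blk hG.lenle 0) Ta
      (fun a b => t * Real.exp (-(δT * g.dist a b))))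
    (htb : HasMaj (cNorm R₀ H₀ blk hG.lenle 2) (cNorm R₀ H₀ blkW hG.lenle 1) Tb
      (fun a b => t * Real.exp (-(δT * g.dist a b)))) :
    HasMaj (cNorm R₀ H₀ blk hG.lenle 2) (cNorm R₀ H₀ blk hG.lenle 2) (G0 ∘ₗ T)
      (fun a b => (B₀ + B₃) * t * c * Real.exp (-(ρ * g.dist a b))) := by
  have htri : Triangle254 (toB6 g R₀ H₀) := fun a b c => hG.tri a b c
  have h1 := hasMaj_comp_exp htri hG.dnn hrow hB₀ ht hρ hρT hρ₀ hG0 hta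
  have h2 := hasMaj_comp_exp htri hG.dnn hrow hB₃ ht hρ hρT hρ₃ hGD htb
  have hsum := h1.add h2
  refine (hsum.congr fun μ => ?_).mono fun a b => le_of_eq ?_
  · rw [hsplit]
    simp only [LinearMap.add_apply, LinearMap.comp_apply, map_add]
  · simp only [cNorm_κ, toB6_dist]
    ring

/-- **ONE SCALE TRANSFER — FROM THE CLASS 𝔠⁽²⁾ TO THE CLASS 𝔠⁽¹⁾** (p. 398: *"Using Lemma 2.1 in [4] we may replace the factor
(Lʲη)^α by (Lʲη)^β(L^{j′}η)^γ with β + γ = α"*): a majorant C·e^{−rd} of T from 𝔠_V⁽²⁾ into 𝔠⁽²⁾ is the majorant C·L₀·e^{−(r−αδ)d}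
of T from 𝔠_V⁽¹⁾ into 𝔠⁽¹⁾ — the ratio Lʲη ∕ L^{j′}η costs L₀·e^{αδd(y,y′)} by [4] (2.60) in the form of n06-k's member facts
`Facts347` (`scaleTransfer_len_rpow` at γ = 1; d symmetric).
[cite: Balaban1985BackgroundPropagators, p.398 (remark after (3.47)); Balaban1984PropagatorsII, Lemma 2.1 (2.60) p.234] -/
theorem hasMaj_cNorm_one_of_two (hG : GeoOK g) {d : ℕ} {δ α L₀ : ℝ} (hF : Facts347 g R₀ H₀ d δ α L₀)
    {V : Type} [Fintype V] {blkV : V → g.Site} {blk : X → g.Site} {T : (V → ℝ) →ₗ[ℝ] (X → ℝ)} {C r : ℝ} (hC : 0 ≤ C)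
    (h : HasMaj (cNorm R₀ H₀ blkV hG.lenle 2) (cNorm R₀ H₀ blk hG.lenle 2) T
      (fun a b => C * Real.exp (-(r * g.dist a b)))) :
    HasMaj (cNorm R₀ H₀ blkV hG.lenle 1) (cNorm R₀ H₀ blk hG.lenle 1) T
      (fun a b => C * L₀ * Real.exp (-((r - α * δ) * g.dist a b))) := by
  intro y' μ hμ y
  have hb := h y' μ hμ y
  simp only [cNorm, weightNorm_loc, wt, pow_one] at hb ⊢
  set N := (BlockNorm.ofBlocks (toB6 g R₀ H₀) blk).loc y (T μ) with hN
  set N' := (BlockNorm.ofBlocks (toB6 g R₀ H₀) blkV).loc y' μ with hN'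
  have hN'0 : 0 ≤ N' := (BlockNorm.ofBlocks (toB6 g R₀ H₀) blkV).loc_nonneg y' μ
  have hy : 0 < g.len y := hG.lenpos y
  have hy' : 0 < g.len y' := hG.lenpos y'
  -- the transfer at γ = 1: e^{−αδd(y,y′)}·Lʲη ≦ L₀·L^{j′}η
  have hkey : Real.exp (-(r * g.dist y y')) * g.len y ≤
      L₀ * Real.exp (-((r - α * δ) * g.dist y y')) * g.len y' := by
    have hst := scaleTransfer_len_rpow hF 1 (by norm_num) y' y
    simp only [abs_one, Real.rpow_one] at hst
    rw [hG.symm y' y] at hst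
    have h2 : Real.exp (-(α * δ * g.dist y y')) * g.len y ≤ L₀ * g.len y' :=
      hst.trans (mul_le_mul_of_nonneg_right hF.L_le hy'.le)
    have hsplit : Real.exp (-(r * g.dist y y')) =
        Real.exp (-((r - α * δ) * g.dist y y')) * Real.exp (-(α * δ * g.dist y y')) := by
      rw [← Real.exp_add]; congr 1; ring
    rw [hsplit, mul_assoc]
    calc Real.exp (-((r - α * δ) * g.dist y y')) * (Real.exp (-(α * δ * g.dist y y')) * g.len y)
        ≤ Real.exp (-((r - α * δ) * g.dist y y')) * (L₀ * g.len y') := mul_le_mul_of_nonneg_left h2 (Real.exp_nonneg _)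
      _ = L₀ * Real.exp (-((r - α * δ) * g.dist y y')) * g.len y' := by ring
  -- unweight the hypothesis, reweight the goal
  have h1 : N ≤ g.len y ^ 2 * (C * Real.exp (-(r * g.dist y y')) * ((g.len y' ^ 2)⁻¹ * N')) :=
    (inv_mul_le_iff₀ (pow_pos hy 2)).mp hb
  refine (inv_mul_le_iff₀ hy).mpr (h1.trans ?_)
  have hinv : g.len y' * (g.len y')⁻¹ = 1 := mul_inv_cancel₀ hy'.ne'
  have hsq : (g.len y' ^ 2)⁻¹ = (g.len y')⁻¹ * (g.len y')⁻¹ := by rw [sq, mul_inv]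
  have hfac : 0 ≤ C * N' * (g.len y * (g.len y')⁻¹) :=
    mul_nonneg (mul_nonneg hC hN'0) (mul_nonneg hy.le (inv_nonneg.mpr hy'.le))
  calc g.len y ^ 2 * (C * Real.exp (-(r * g.dist y y')) * ((g.len y' ^ 2)⁻¹ * N'))
      = C * N' * (g.len y * (g.len y')⁻¹) * ((Real.exp (-(r * g.dist y y')) * g.len y) * (g.len y')⁻¹) := by
        rw [hsq]; ring
    _ ≤ C * N' * (g.len y * (g.len y')⁻¹) * ((L₀ * Real.exp (-((r - α * δ) * g.dist y y')) * g.len y') * (g.len y')⁻¹) :=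
        mul_le_mul_of_nonneg_left (mul_le_mul_of_nonneg_right hkey (inv_nonneg.mpr hy'.le)) hfac
    _ = C * N' * (g.len y * (g.len y')⁻¹) * (L₀ * Real.exp (-((r - α * δ) * g.dist y y'))) * (g.len y' * (g.len y')⁻¹) := by
        ring
    _ = g.len y * (C * L₀ * Real.exp (-((r - α * δ) * g.dist y y')) * ((g.len y')⁻¹ * N')) := by
        rw [hinv]; ring

/-! ## §3 The sup-class step of rows 20–21 from Theorem 3.3 for G₀ and the letters -/

/-- **THE STEP ON 𝔠⁽²⁾ FOR Δ′_π AND Δ′_π + Δ⁽²⁾_π** from Theorem 3.3 (3.42)₁ for G₀, the G₀D entry and the letters `Letters3131`: G₀Δ′_π has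
the majorant (B₀ + B₃)·t·c·e^{−ρd} and G₀(Δ′_π + Δ⁽²⁾_π) the majorant 2(B₀ + B₃)·t·c·e^{−ρd} on 𝔠⁽²⁾ (ρ ≧ 0, ρ ≦ δ_T, ρ + σ ≦ δ₀, ρ + σ ≦ δ₃).
[cite: Balaban1985BackgroundPropagators, (3.130)–(3.131) pp.421–422 + (3.137)–(3.138) p.423 + Thm 3.3 p.399; Balaban1984PropagatorsII, (2.54) p.233 + (2.61) p.234] -/
theorem step_two_of_letters3131 (hG : GeoOK g) {𝔬 : Ops g B X Y Z W} {Ta Ta₂ : B.Cfg → Module.End ℝ (X → ℝ)}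
    {Tb Tb₂ : B.Cfg → (X → ℝ) →ₗ[ℝ] (W → ℝ)} {U : B.Cfg} {B₀ B₃ t δ₀ δ₃ δT ρ σ c : ℝ}
    (hrow : RowSum (toB6 g R₀ H₀) σ c) (hB₀ : 0 ≤ B₀) (hB₃ : 0 ≤ B₃) (ht : 0 ≤ t) (hρ : 0 ≤ ρ) (hρT : ρ ≤ δT)
    (hρ₀ : ρ + σ ≤ δ₀) (hρ₃ : ρ + σ ≤ δ₃) (h33 : Thm33G0 𝔬 R₀ H₀ B₀ δ₀ U)
    (hgD : HasMaj (cNorm R₀ H₀ 𝔬.blkW hG.lenle 1) (cNorm R₀ H₀ 𝔬.blk hG.lenle 2) (𝔬.G0 U ∘ₗ 𝔬.Dv U)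
      (fun a b => B₃ * Real.exp (-(δ₃ * g.dist a b))))
    (hL : Letters3131 𝔬 Ta Ta₂ Tb Tb₂ R₀ H₀ hG.lenle t δT U) :
    HasMaj (cNorm R₀ H₀ 𝔬.blk hG.lenle 2) (cNorm R₀ H₀ 𝔬.blk hG.lenle 2) (𝔬.G0 U ∘ₗ 𝔬.Tpi U)
        (fun a b => (B₀ + B₃) * t * c * Real.exp (-(ρ * g.dist a b))) ∧
      HasMaj (cNorm R₀ H₀ 𝔬.blk hG.lenle 2) (cNorm R₀ H₀ 𝔬.blk hG.lenle 2) (𝔬.G0 U ∘ₗ (𝔬.Tpi U + 𝔬.T2 U))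
        (fun a b => 2 * ((B₀ + B₃) * t * c) * Real.exp (-(ρ * g.dist a b))) := by
  have hG0 := hasMaj_G0_cNorm (R₀ := R₀) (H₀ := H₀) hG hB₀ h33.e0
  have hA := hasMaj_G0_comp_split hG hrow hB₀ hB₃ ht hρ hρT hρ₀ hρ₃ hL.split hG0 hgD hL.ta hL.tb
  have hB := hasMaj_G0_comp_split hG hrow hB₀ hB₃ ht hρ hρT hρ₀ hρ₃ hL.split₂ hG0 hgD hL.ta₂ hL.tb₂
  refine ⟨hA, ?_⟩
  refine ((hA.add hB).congr fun μ => ?_).mono fun a b => le_of_eq ?_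
  · simp only [LinearMap.add_apply, LinearMap.comp_apply, map_add]
  · ring

/-- **THE STEP ON 𝔠⁽¹⁾**, by the scale transfer `hasMaj_cNorm_one_of_two` of the 𝔠⁽²⁾ step: G₀Δ′_π has the majorant
(B₀ + B₃)·t·c·L₀·e^{−(ρ−αδ)d} and G₀(Δ′_π + Δ⁽²⁾_π) the majorant 2(B₀ + B₃)·t·c·L₀·e^{−(ρ−αδ)d} on 𝔠⁽¹⁾.
[cite: Balaban1985BackgroundPropagators, (3.130)–(3.131) pp.421–422 + (3.138) p.423 + p.398 (remark after (3.47)); Balaban1984PropagatorsII, Lemma 2.1 (2.60) p.234] -/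
theorem step_one_of_letters3131 (hG : GeoOK g) {𝔬 : Ops g B X Y Z W} {Ta Ta₂ : B.Cfg → Module.End ℝ (X → ℝ)}
    {Tb Tb₂ : B.Cfg → (X → ℝ) →ₗ[ℝ] (W → ℝ)} {U : B.Cfg} {d : ℕ} {δ α L₀ : ℝ} (hF : Facts347 g R₀ H₀ d δ α L₀)
    {B₀ B₃ t δ₀ δ₃ δT ρ σ c : ℝ}
    (hrow : RowSum (toB6 g R₀ H₀) σ c) (hc : 0 ≤ c) (hB₀ : 0 ≤ B₀) (hB₃ : 0 ≤ B₃) (ht : 0 ≤ t) (hρ : 0 ≤ ρ) (hρT : ρ ≤ δT)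
    (hρ₀ : ρ + σ ≤ δ₀) (hρ₃ : ρ + σ ≤ δ₃) (h33 : Thm33G0 𝔬 R₀ H₀ B₀ δ₀ U)
    (hgD : HasMaj (cNorm R₀ H₀ 𝔬.blkW hG.lenle 1) (cNorm R₀ H₀ 𝔬.blk hG.lenle 2) (𝔬.G0 U ∘ₗ 𝔬.Dv U)
      (fun a b => B₃ * Real.exp (-(δ₃ * g.dist a b))))
    (hL : Letters3131 𝔬 Ta Ta₂ Tb Tb₂ R₀ H₀ hG.lenle t δT U) :
    HasMaj (cNorm R₀ H₀ 𝔬.blk hG.lenle 1) (cNorm R₀ H₀ 𝔬.blk hG.lenle 1) (𝔬.G0 U ∘ₗ 𝔬.Tpi U)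
        (fun a b => (B₀ + B₃) * t * c * L₀ * Real.exp (-((ρ - α * δ) * g.dist a b))) ∧
      HasMaj (cNorm R₀ H₀ 𝔬.blk hG.lenle 1) (cNorm R₀ H₀ 𝔬.blk hG.lenle 1) (𝔬.G0 U ∘ₗ (𝔬.Tpi U + 𝔬.T2 U))
        (fun a b => 2 * ((B₀ + B₃) * t * c) * L₀ * Real.exp (-((ρ - α * δ) * g.dist a b))) := by
  obtain ⟨hA, hB⟩ := step_two_of_letters3131 hG hrow hB₀ hB₃ ht hρ hρT hρ₀ hρ₃ h33 hgD hL
  have hK : 0 ≤ (B₀ + B₃) * t * c := mul_nonneg (mul_nonneg (add_nonneg hB₀ hB₃) ht) hc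
  exact ⟨hasMaj_cNorm_one_of_two hG hF hK hA,
    hasMaj_cNorm_one_of_two hG hF (mul_nonneg (by norm_num) hK) hB⟩

/-- ★ **THE SUP-CLASS SECT.-D STEP OF ROWS 20–21 FROM THEOREM 3.3 FOR G₀ AND THE (3.131) ∕ (3.137) LETTERS** — the two conjuncts
`Step 𝔬 R₀ H₀ hlen 1 θ δK U` and `Step 𝔬 R₀ H₀ hlen 2 θ δK U` of the Sect.-D leaves' model binder (n06-d's `hmodel12`, conjuncts 2–3),
i.e. the block majorant θe^{−δ_K d} of K′ = G₀Δ′_π and K′₁ = G₀(Δ′_π + Δ⁽²⁾_π) on 𝔠⁽¹⁾ and on 𝔠⁽²⁾ (p. 422: *"This inequality [(3.131)]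
and Theorem 3.3 for G₀ imply a convergence of the series (3.130)"*; p. 423 for (3.138)), PROVED from: Theorem 3.3 (3.42)₁ for G₀
(`Thm33G0`, field `e0` — after `B9Thm312WholeFromThm310.thm33G0_of_conv3107` a theorem of rows 18's Theorem 3.10), the G₀D entry of
Theorem 3.3's type (the shape of `B9Thm313Whole.Letters313.gD2`), the letters `Letters3131` (Δ′_π = T_a + D·T_b, Δ⁽²⁾_π = T_a₂ + D·T_b₂,
small local majorants t·e^{−δ_T d}), [4] Lemma 2.1 (2.61) as the row sum at rate σ, and the p. 398 transfer through `Facts347` —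
for EVERY θ ≧ 2(B₀ + B₃)·t·c·L₀ and every δ_K ≦ ρ − αδ, where 0 ≦ ρ ≦ δ_T, ρ + σ ≦ min(δ₀, δ₃), αδ ≧ 0.  In print t, hence θ, is
O(1)·Mα₀.  The steps in the other classes, `FormSmall` and `Identities` are untouched.
[cite: Balaban1985BackgroundPropagators, Thm 3.12 p.423 + (3.130)–(3.131) pp.421–422 + (3.137)–(3.138) p.423 + Thm 3.3 p.399 + p.398 (remark after (3.47)); Balaban1984PropagatorsII, Lemma 2.1 (2.60)–(2.61) p.234 + (2.54) p.233] -/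
theorem step_of_letters3131 (hG : GeoOK g) {𝔬 : Ops g B X Y Z W} {Ta Ta₂ : B.Cfg → Module.End ℝ (X → ℝ)}
    {Tb Tb₂ : B.Cfg → (X → ℝ) →ₗ[ℝ] (W → ℝ)} {U : B.Cfg} {d : ℕ} {δ α L₀ : ℝ} (hF : Facts347 g R₀ H₀ d δ α L₀)
    {B₀ B₃ t δ₀ δ₃ δT ρ σ c θ δK : ℝ}
    (hrow : RowSum (toB6 g R₀ H₀) σ c) (hc : 0 ≤ c) (hB₀ : 0 ≤ B₀) (hB₃ : 0 ≤ B₃) (ht : 0 ≤ t) (hρ : 0 ≤ ρ) (hρT : ρ ≤ δT)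
    (hρ₀ : ρ + σ ≤ δ₀) (hρ₃ : ρ + σ ≤ δ₃) (hαδ : 0 ≤ α * δ) (hθ : 2 * ((B₀ + B₃) * t * c) * L₀ ≤ θ)
    (hδKρ : δK + α * δ ≤ ρ) (h33 : Thm33G0 𝔬 R₀ H₀ B₀ δ₀ U)
    (hgD : HasMaj (cNorm R₀ H₀ 𝔬.blkW hG.lenle 1) (cNorm R₀ H₀ 𝔬.blk hG.lenle 2) (𝔬.G0 U ∘ₗ 𝔬.Dv U)
      (fun a b => B₃ * Real.exp (-(δ₃ * g.dist a b))))
    (hL : Letters3131 𝔬 Ta Ta₂ Tb Tb₂ R₀ H₀ hG.lenle t δT U) :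
    Step 𝔬 R₀ H₀ hG.lenle 1 θ δK U ∧ Step 𝔬 R₀ H₀ hG.lenle 2 θ δK U := by
  obtain ⟨h2A, h2B⟩ := step_two_of_letters3131 hG hrow hB₀ hB₃ ht hρ hρT hρ₀ hρ₃ h33 hgD hL
  obtain ⟨h1A, h1B⟩ := step_one_of_letters3131 hG hF hrow hc hB₀ hB₃ ht hρ hρT hρ₀ hρ₃ h33 hgD hL
  have hK : 0 ≤ (B₀ + B₃) * t * c := mul_nonneg (mul_nonneg (add_nonneg hB₀ hB₃) ht) hc
  have hL₁ : 1 ≤ L₀ := hF.one_le_L.trans hF.L_le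
  have hL₀ : 0 ≤ L₀ := zero_le_one.trans hL₁
  -- the four constants against θ
  have hc1 : (B₀ + B₃) * t * c * L₀ ≤ θ := by nlinarith
  have hc1' : 2 * ((B₀ + B₃) * t * c) * L₀ ≤ θ := hθ
  have hc2 : (B₀ + B₃) * t * c ≤ θ := by nlinarith
  have hc2' : 2 * ((B₀ + B₃) * t * c) ≤ θ := by nlinarith
  -- the two rates against δ_K
  have hr1 : δK ≤ ρ - α * δ := by linarith
  have hr2 : δK ≤ ρ := by linarith
  refine ⟨⟨?_, ?_⟩, ⟨?_, ?_⟩⟩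
  · exact h1A.mono fun a b => by
      simp only [toB6_dist]
      exact kernel_le (mul_nonneg hK hL₀) hc1 hr1 (hG.dnn a b)
  · exact h1B.mono fun a b => by
      simp only [toB6_dist]
      exact kernel_le (mul_nonneg (mul_nonneg (by norm_num) hK) hL₀) hc1' hr1 (hG.dnn a b)
  · exact h2A.mono fun a b => by
      simp only [toB6_dist]
      exact kernel_le hK hc2 hr2 (hG.dnn a b)
  · exact h2B.mono fun a b => by
      simp only [toB6_dist]
      exact kernel_le (mul_nonneg (by norm_num) hK) hc2' hr2 (hG.dnn a b)

end

end Literature.MathematicalPhysics.QuantumFieldTheory.Balaban1983to89.B9Thm312WholeStepFrom3131
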